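import Mathlib
import Summits.QuantumFields.YangMills.Theses.GronwallGap
import Summits.QuantumFields.YangMills.Theses.DirichletWindow
import Summits.QuantumFields.YangMills.Theses.ConvexGribovBody
import Summits.QuantumFields.YangMills.Theorems.ComplexCouplingChannelContinuumLegGivenGapSplit
import Summits.QuantumFields.YangMills.Theorems.GronwallGapContinuumFromLatticeGapStubLockOffE
import Summits.QuantumFields.YangMills.Theorems.GronwallGapContinuumFromLatticeGapStubCriticalOfLock
import Literature.MathematicalPhysics.QuantumFieldTheory.MassGapFromLatticeClustering
import HarnessLib

/-!
# `ContinuumFromLatticeGap` (stmt-QuantumFields-15915, route `GronwallGap`): the typed SPLIT of the shared UV leg — `continuumFromLatticeGap_of_subs`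

The DEF-FREE Theorems rendering of the skeleton of line `registered` (reshape 2,
`Cruxes/ContinuumFromLatticeGap/Lines/birth.lean`, lead prover-line-stmt-QuantumFields-15915-0) with its two open
registered stubs turned into hypotheses, written out verbatim:

`continuumFromLatticeGap_of_subs : DirichletWindow.XiDiverges → ⟨stub_uvPackageVol⟩ → ⟨stub_skewWindow⟩ →
  GronwallGap.ContinuumFromLatticeGap`.

* `XiDiverges` — stmt-QuantumFields-8941 (route DirichletWindow) BY NAME: criticality of the curvature correlation length.
* ⟨stub_uvPackageVol⟩ — the volume-uniform UV engine at the gap-pinned unit ((UUVB) ∧ (ND) ∧ (ROT₃₄₅) for every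
  canonically normalised exactly centred admissible scheme; Bałaban / Magnen–Rivasseau–Sénéor class; open) — VERBATIM the
  registered open stub of the sibling crux stmt-QuantumFields-15828 (`ContinuumLegGivenGap`, line `Sketch`), i.e. the same
  proposition as the second hypothesis of `ContinuumLegGivenGap_of_subs`.
* ⟨stub_skewWindow⟩ — the NLO skewness window of `tr F²` (stmt-9118 class with (CL) ↦ (CL-t); open) — likewise verbatim.

So the two cruxes 15915 (hypothesis: gap at every `β > 0` OFF a locally finite, possibly unbounded, exceptional set,
per-pair thresholds) and 15828 (gap at all `β ≥ β₀`, pair-free threshold) have ONE AND THE SAME open content: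
`continuumFromLatticeGap_and_continuumLegGivenGap_of_subs`. What is specific to 15915 is its IR leg, and that is LANDED:
the lock off the exceptional set `stub_lockOffE` (p147376: couplings `β_k ∈ (B + k, B + k + 1) ∖ E`, per-pair threshold
absorption, then the reflection-positivity core `stub_rpCore` and the one-sided diagonal argument of `stub_lockOfRpCore`)
and criticality of the locked rates from the lock alone `stub_criticalOfLock` (p147095: `rate_lt_of_sharp` +
`sharp_eventually_of_xiDiverges`). The rest of the composition is stmt-15828's landed split verbatim: part A
`cclgSplit_uvPackage_exists` (scheme, (CSCL), (ROT), (CL-t), (UCL), translations), `cclgSplit_gap_of_locked`,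
`cclgSplit_ng_of_pinned`, `stub_extract`, `cclgSplit_pt_package_subScheme`, route ParabolicTrajectory's `oneFieldOSLegs'`
(OS data, `IsYangMillsFor`, `IsNontrivial`, `IsNonGaussian`), Literature `IsYangMillsFor.hasMassGap_of_hasCSClustering`
(continuum gap from (CSCL)) and `hasLatticeMassGap_subScheme`; both gaps at `Δ = min Δ₀ Δ₁`; `β ∘ φ ∘ ψ → ∞` is
`HasWeakCouplingLimit`. A conditional composition over landed theorems: it credits nothing by itself (audit:
`proof.conditional` on the two hypotheses and on `XiDiverges`). [folklore]
-/

noncomputable section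

namespace Summit.QuantumFields.YangMills.Theorems.ContinuumFromLatticeGap

open scoped SchwartzMap
open Filter Topology MeasureTheory
open Literature.MathematicalPhysics.QuantumFieldTheory Literature.MathematicalPhysics.QuantumLattice
  Literature.MathematicalPhysics.AQFT Literature.Probability.LatticeModels
open Literature.Barriers.QuantumFields (subScheme hasLatticeMassGap_subScheme)
open Summit.QuantumFields.YangMills.Theses
open Summit.QuantumFields.YangMills.Theorems.ContinuumLegGivenGap
open Summit.QuantumFields.YangMills.Cruxes.ContinuumLimitOnTrajectory.TwoOrbitSynchronisation
  (curvDistribution canon UUVB ND2 ND3 UCL AsympEuclid AsympTransl AsympRot ConvProducts oneFieldOSLegs')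

variable {G : Type} [Group G] [TopologicalSpace G] [IsTopologicalGroup G] [CompactSpace G]

omit [Group G] [TopologicalSpace G] [IsTopologicalGroup G] [CompactSpace G] in
/-- Anchor (registered sub-goal `stub_splitAnchor` of stmt-QuantumFields-15915 for this file): the weak-coupling bookkeeping —
couplings `b_k = β_{φ k}` of a scheme built on locked data (`β_k → ∞`, `φ` strictly increasing) run to infinity. [folklore] -/
theorem stub_splitAnchor : ∀ (β : ℕ → ℝ) (φ : ℕ → ℕ) (b : ℕ → ℝ), Tendsto β atTop atTop → StrictMono φ →
    (∀ k, b k = β (φ k)) → Tendsto b atTop atTop := by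
  intro β φ b hβ hφ hb
  rw [show b = fun k => β (φ k) from funext hb]
  exact hβ.comp hφ.tendsto_atTop

/-- **The composition at one gauge group** (the body of `ContinuumFromLatticeGap_of` of line `registered`, def-free):
under `XiDiverges`, the UV-engine hypothesis and the skewness-window hypothesis, the crux's hypothesis at a compact simple
`G` (Borel σ-algebra; every `r` has the torus gap at every `β > 0` off a locally finite exceptional set, per-pair constants
and thresholds) yields the re-typed `YangMills` existential for `G`. [folklore] -/
theorem cflgSplit_concl [MeasurableSpace G] [BorelSpace G] (hXi : DirichletWindow.XiDiverges)
    (hUV : (∀ (G : Type) [Group G] [TopologicalSpace G] [IsTopologicalGroup G] [CompactSpace G]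
      [MeasurableSpace G] [BorelSpace G], IsCompactSimpleLieGroup G → ∃ r : LatticeRep G,
      ∀ (β : ℕ → ℝ) (mh : ℕ → ℝ) (S₁ : ℕ → ℕ) (K : ℝ), Tendsto β atTop atTop → (∀ k, 0 < mh k) → 0 < K →
      (∀ A B : YMSpecies G, ∃ C : ℝ, ∀ k S n : ℕ, S₁ k ≤ S → n ≤ S →
        |latticeConnectedCorr r.ρ (β k) (2 * S + 1) A.F B.F n| ≤ C * Real.exp (-(mh k * n))) →
      (∀ k S₀ : ℕ, ∃ A B : YMSpecies G, ∀ C : ℝ, ∃ S n : ℕ, S₀ ≤ S ∧ n ≤ S ∧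
        C * Real.exp (-(K * mh k * n)) < |latticeConnectedCorr r.ρ (β k) (2 * S + 1) A.F B.F n|) →
      Tendsto mh atTop (𝓝 0) →
      ∃ (a : ℕ → ℝ) (φ : ℕ → ℕ) (Δ₀ : ℝ) (𝓛 : ℕ → Set ℕ),
        (∀ k, 0 < a k) ∧ StrictMono φ ∧ 0 < Δ₀ ∧ (∀ k, Δ₀ * a k ≤ mh (φ k)) ∧
        (∀ k S : ℕ, ∃ S' : ℕ, S' ∈ 𝓛 k ∧ S ≤ S') ∧ (∀ k : ℕ, ∀ S ∈ 𝓛 k, S₁ (φ k) ≤ S) ∧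
        (∃ N : ℕ, 1 ≤ N ∧ ∀ᶠ k in atTop, ∀ S ∈ 𝓛 k, (a k)⁻¹ ≤ (a k * (S : ℝ)) ^ N) ∧
      ∀ (sch : SpeciesScheme (YMSpecies G)), (∀ k, sch.a k = a k) → (∀ k, sch.β k = β (φ k)) →
        (∀ k, sch.L k ∈ 𝓛 k) →
      ∀ (LS : (k n : ℕ) → SchwartzMap (Fin n → EuclideanSpace ℝ (Fin 4)) ℂ → ℂ),
      (∀ (k n : ℕ) (F : SchwartzMap (Fin n → EuclideanSpace ℝ (Fin 4)) ℂ), LS k n F =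
        ∫ U : GaugeConfig 4 (sch.side k) G, ∑ x : Fin n → ↥(Literature.Probability.LatticeModels.box 4 (sch.L k)),
          F (fun i => sch.a k • siteToE ↑(x i)) *
            ∏ i, ((sch.c r.curvature k * sch.a k ^ 4 *
              (r.curvature.F (Literature.MathematicalPhysics.QuantumLattice.configShift (-↑(x i)) (Literature.MathematicalPhysics.QuantumLattice.torusLift (sch.side k) U)) - sch.m r.curvature k) : ℝ) : ℂ)
          ∂(wilsonMeasure r.ρ (sch.β k))) →
      (∀ k : ℕ, sch.m r.curvature k =
        ∫ U : GaugeConfig 4 (sch.side k) G, r.curvature.F (Literature.MathematicalPhysics.QuantumLattice.torusLift (sch.side k) U) ∂(wilsonMeasure r.ρ (sch.β k))) →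
      (∀ k : ℕ, sch.c r.curvature k = (sch.a k ^ 4)⁻¹) →
      (∃ (s : ℕ) (α β' : ℝ), ∀ᶠ k in atTop, ∀ (p : ℕ) (q : Fin p → {q : Fin 4 × Fin 4 // q.1 < q.2})
        (F : SchwartzMap (Fin p → EuclideanSpace ℝ (Fin 4)) ℂ), IsOffDiagonal F →
        ‖∫ U : GaugeConfig 4 (sch.side k) G, ∑ x : Fin p → ↥(Literature.Probability.LatticeModels.box 4 (sch.L k)),
            F (fun i => sch.a k • siteToE ↑(x i)) *
              ∏ i, ((plaquetteObs r.ρ 0 (q i).1.1 (q i).1.2 (Literature.MathematicalPhysics.QuantumLattice.configShift (-↑(x i)) (Literature.MathematicalPhysics.QuantumLattice.torusLift (sch.side k) U)) -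
                wilsonTorusMean r.ρ (sch.β k) (sch.L k) (plaquetteObs r.ρ 0 (q i).1.1 (q i).1.2) : ℝ) : ℂ)
            ∂(wilsonMeasure r.ρ (sch.β k))‖ ≤ α * (p.factorial : ℝ) ^ β' * schwartzNorm (p * s) F) ∧
      (∃ (f g : SchwartzMap (Fin 1 → EuclideanSpace ℝ (Fin 4)) ℂ)
        (H : SchwartzMap (Fin (1 + 1) → EuclideanSpace ℝ (Fin 4)) ℂ),
        IsTimeOrdered f ∧ IsTimeOrdered g ∧ IsAppendTensorOf H (osAdjoint f) g ∧
          ∃ δ : ℝ, 0 < δ ∧ ∀ᶠ k in atTop, δ ≤ ‖LS k (1 + 1) H‖) ∧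
      (∀ R : EuclideanSpace ℝ (Fin 4) ≃ₗᵢ[ℝ] EuclideanSpace ℝ (Fin 4),
        R (EuclideanSpace.single 0 1) =
          (3 / 5 : ℝ) • EuclideanSpace.single 0 1 + (-(4 / 5) : ℝ) • EuclideanSpace.single 1 1 →
        R (EuclideanSpace.single 1 1) =
          (4 / 5 : ℝ) • EuclideanSpace.single 0 1 + (3 / 5 : ℝ) • EuclideanSpace.single 1 1 →
        R (EuclideanSpace.single 2 1) = EuclideanSpace.single 2 1 →
        R (EuclideanSpace.single 3 1) = EuclideanSpace.single 3 1 →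
        ∀ (n : ℕ) (F : SchwartzMap (Fin n → EuclideanSpace ℝ (Fin 4)) ℂ), IsOffDiagonal F →
          Tendsto (fun k : ℕ => LS k n (linActMulti R F) - LS k n F) atTop (𝓝 0))))
    (hSk : (∀ (G : Type) [Group G] [TopologicalSpace G] [IsTopologicalGroup G] [CompactSpace G]
      [MeasurableSpace G] [BorelSpace G], IsCompactSimpleLieGroup G →
      ∀ (r : LatticeRep G) (sch : SpeciesScheme (YMSpecies G))
        (LS : (k n : ℕ) → SchwartzMap (Fin n → EuclideanSpace ℝ (Fin 4)) ℂ → ℂ),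
      (∀ (k n : ℕ) (F : SchwartzMap (Fin n → EuclideanSpace ℝ (Fin 4)) ℂ), LS k n F =
        ∫ U : GaugeConfig 4 (sch.side k) G, ∑ x : Fin n → ↥(box 4 (sch.L k)),
          F (fun i => sch.a k • siteToE ↑(x i)) *
            ∏ i, ((sch.c r.curvature k * sch.a k ^ 4 *
              (r.curvature.F (configShift (-↑(x i)) (torusLift (sch.side k) U)) - sch.m r.curvature k) : ℝ) : ℂ)
          ∂(wilsonMeasure r.ρ (sch.β k))) →
      Tendsto sch.β atTop atTop →
      (∀ k : ℕ, sch.m r.curvature k =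
        ∫ U : GaugeConfig 4 (sch.side k) G, r.curvature.F (torusLift (sch.side k) U) ∂(wilsonMeasure r.ρ (sch.β k))) →
      (∃ (s : ℕ) (α β' : ℝ), ∀ (n : ℕ) (F : SchwartzMap (Fin n → EuclideanSpace ℝ (Fin 4)) ℂ),
        IsOffDiagonal F → ∀ᶠ k in atTop, ‖LS k n F‖ ≤ α * (n.factorial : ℝ) ^ β' * schwartzNorm (n * s) F) →
      (∃ (f g : SchwartzMap (Fin 1 → EuclideanSpace ℝ (Fin 4)) ℂ)
        (H : SchwartzMap (Fin (1 + 1) → EuclideanSpace ℝ (Fin 4)) ℂ),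
        IsTimeOrdered f ∧ IsTimeOrdered g ∧ IsAppendTensorOf H (osAdjoint f) g ∧
          ∃ δ : ℝ, 0 < δ ∧ ∀ᶠ k in atTop, δ ≤ ‖LS k (1 + 1) H‖) →
      (∃ Δ : ℝ, 0 < Δ ∧ ∀ (n m : ℕ) (F : SchwartzMap (Fin n → EuclideanSpace ℝ (Fin 4)) ℂ)
        (G' : SchwartzMap (Fin m → EuclideanSpace ℝ (Fin 4)) ℂ), IsTimeOrdered F → IsTimeOrdered G' →
        ∃ C : ℝ, ∀ t : ℝ, 0 ≤ t → ∀ᶠ k in atTop,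
          ∀ H : SchwartzMap (Fin (n + m) → EuclideanSpace ℝ (Fin 4)) ℂ,
            IsAppendTensorOf H (osAdjoint F) (translateMulti (EuclideanSpace.single 0 t) G') →
              ‖LS k (n + m) H - LS k n (osAdjoint F) * LS k m G'‖ ≤ C * Real.exp (-Δ * t)) →
      ∃ (s₃ : ℂ) (φ : ℕ → ℕ) (f g h : ℕ → SchwartzMap (EuclideanSpace ℝ (Fin 4)) ℂ)
        (F₃ : ℕ → SchwartzMap (Fin 3 → EuclideanSpace ℝ (Fin 4)) ℂ) (w : ℕ → ℝ),
        s₃ ≠ 0 ∧ StrictMono φ ∧ (∀ j, 0 < w j) ∧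
          (∀ j, IsTensorOf (F₃ j) ![f j, g j, h j] ∧ IsOffDiagonal (F₃ j)) ∧
          ∀ ε : ℝ, 0 < ε → ∀ᶠ j in atTop, ∀ᶠ k in atTop, ‖LS (φ k) 3 (F₃ j) / (w j : ℂ) - s₃‖ ≤ ε))
    (hG : IsCompactSimpleLieGroup G)
    (hgap : ∀ r : LatticeRep G,
      ∃ E : Set ℝ, (∀ b : ℝ, (E ∩ Set.Icc 0 b).Finite) ∧ ∀ β : ℝ, 0 < β → β ∉ E → ∃ m : ℝ, 0 < m ∧
        ∀ A B : YMSpecies G, ∃ C : ℝ, ∃ S₀ : ℕ, ∀ S : ℕ, S₀ ≤ S → ∀ n : ℕ, n ≤ S →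
          |latticeConnectedCorr r.ρ β (2 * S + 1) A.F B.F n| ≤ C * Real.exp (-(m * n))) :
    ∃ (r : LatticeRep G) (sch : SpeciesScheme (YMSpecies G)) (T : OSData (YMSpecies G) 4),
      sch.HasWeakCouplingLimit ∧ IsYangMillsFor r sch T ∧ T.IsNontrivial r.curvature ∧
        T.IsNonGaussian r.curvature ∧ ∃ Δ > 0, T.HasMassGap Δ ∧ HasLatticeMassGap r sch Δ := by
  -- the UV engine chooses the representation
  obtain ⟨r, huv⟩ := cclgSplit_uvPackage_exists hUV hG
  -- Step 1 (IR): the lock off the exceptional set, from the crux's hypothesis at `r`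
  obtain ⟨β, mh, S₁, K, hL⟩ := stub_lockOffE hXi G hG r (hgap r)
  -- Step 2: criticality of the locked rates
  have hcrit : Tendsto mh atTop (𝓝 0) := stub_criticalOfLock hXi G hG r β mh S₁ hL.1 hL.2.1 hL.2.2.2.1
  -- Step 3 (UV): the scheme and its packages, fed the locked critical datum
  obtain ⟨sch, φ, Δ₀, hφ, hβ, hΔ₀, ha, hLk, hVS, hCAN, hUU, hND, hCLt, hUCL, hPVG, hEUC, hROT, Δ₁, hΔ₁, hCS⟩ :=
    huv β mh S₁ K hL hcrit
  have hAF : Tendsto sch.β atTop atTop := stub_splitAnchor β φ sch.β hL.1 hφ hβ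
  have hUVB : Summit.QuantumFields.YangMills.Cruxes.ContinuumLimitOnTrajectory.TwoOrbitSynchronisation.UVB r sch :=
    Summit.QuantumFields.YangMills.Cruxes.ContinuumLimitOnTrajectory.TwoOrbitSynchronisation.uvb_of_uuvb r _ hUU
  have hGAP : HasLatticeMassGap r sch Δ₀ := cclgSplit_gap_of_locked r hL.2.2.2.1 hβ ha hLk
  -- the skewness floor, frequently; a sub-scheme inside that set with convergent products
  obtain ⟨f₃, g₃, h₃, F₃, hT₃, hO₃, δ, hδ, hfreq⟩ := cclgSplit_ng_of_pinned hSk hG r sch hAF hCAN hVS hUVB hND hCLt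
  have hUUraw : (∃ (s : ℕ) (α β' : ℝ), ∀ᶠ k in atTop, ∀ (p : ℕ) (q : Fin p → {q : Fin 4 × Fin 4 // q.1 < q.2})
        (F : SchwartzMap (Fin p → EuclideanSpace ℝ (Fin 4)) ℂ), IsOffDiagonal F →
        ‖∫ U : GaugeConfig 4 (sch.side k) G, ∑ x : Fin p → ↥(box 4 (sch.L k)),
            F (fun i => sch.a k • siteToE ↑(x i)) *
              ∏ i, ((plaquetteObs r.ρ 0 (q i).1.1 (q i).1.2 (configShift (-↑(x i)) (torusLift (sch.side k) U)) -
                wilsonTorusMean r.ρ (sch.β k) (sch.L k) (plaquetteObs r.ρ 0 (q i).1.1 (q i).1.2) : ℝ) : ℂ)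
            ∂(wilsonMeasure r.ρ (sch.β k))‖ ≤ α * (p.factorial : ℝ) ^ β' * schwartzNorm (p * s) F) := by
    obtain ⟨s, α, β', h⟩ := hUU
    exact ⟨s, α, β', h⟩
  obtain ⟨ψ, hψ, hψS, hconv⟩ := stub_extract G r sch hUUraw {k | δ ≤ ‖curvDistribution r sch k 3 F₃‖} hfreq
  obtain ⟨hUVB2, hARP2, hND2, hUCL2, hE1⟩ := cclgSplit_pt_package_subScheme r sch hAF hUU hND hUCL hEUC hROT ψ hψ
  have hND3 : ND3 r (subScheme sch ψ hψ) :=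
    ⟨f₃, g₃, h₃, F₃, hT₃, hO₃, δ, hδ, Eventually.of_forall fun k => hψS k⟩
  -- Step 4 (OS): the proved one-field OS packaging of route ParabolicTrajectory
  obtain ⟨T, hYM, hNT, hNGT⟩ := oneFieldOSLegs' G r (subScheme sch ψ hψ) hconv hUVB2 hE1 hARP2 hUCL2 hND2 hND3
  -- Step 5: the two gaps at the common rate, read off (CSCL) and the lock
  have hΔ : 0 < min Δ₀ Δ₁ := cclgSplit_min_pos Δ₀ Δ₁ hΔ₀ hΔ₁
  have hLG : HasLatticeMassGap r (canon r (subScheme sch ψ hψ)) (min Δ₀ Δ₁) :=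
    cclgSplit_hasLatticeMassGap_mono r (subScheme sch ψ hψ) (min_le_left _ _) (hasLatticeMassGap_subScheme hGAP ψ hψ)
  have hCS2 : SpeciesScheme.HasCSClustering r (canon r (subScheme sch ψ hψ)) (min Δ₀ Δ₁) :=
    cclgSplit_hasCSClustering_mono r _ (min_le_right _ _) (cclgSplit_hasCSClustering_canon_subScheme r sch ψ hψ hCS)
  refine ⟨r, canon r (subScheme sch ψ hψ), T, ?_, hYM, hNT, hNGT, min Δ₀ Δ₁, hΔ,
    hYM.hasMassGap_of_hasCSClustering hCS2, hLG⟩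
  show Tendsto (canon r (subScheme sch ψ hψ)).β atTop atTop
  exact hAF.comp hψ.tendsto_atTop

/-- **`continuumFromLatticeGap_of_subs`** — the typed split of crux stmt-QuantumFields-15915: criticality `XiDiverges`
(stmt-8941), the volume-uniform UV engine (the registered `stub_uvPackageVol` verbatim) and the NLO skewness window (the
registered `stub_skewWindow` verbatim) imply `GronwallGap.ContinuumFromLatticeGap`. [folklore] -/
theorem continuumFromLatticeGap_of_subs :
    DirichletWindow.XiDiverges →
    (∀ (G : Type) [Group G] [TopologicalSpace G] [IsTopologicalGroup G] [CompactSpace G]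
      [MeasurableSpace G] [BorelSpace G], IsCompactSimpleLieGroup G → ∃ r : LatticeRep G,
      ∀ (β : ℕ → ℝ) (mh : ℕ → ℝ) (S₁ : ℕ → ℕ) (K : ℝ), Tendsto β atTop atTop → (∀ k, 0 < mh k) → 0 < K →
      (∀ A B : YMSpecies G, ∃ C : ℝ, ∀ k S n : ℕ, S₁ k ≤ S → n ≤ S →
        |latticeConnectedCorr r.ρ (β k) (2 * S + 1) A.F B.F n| ≤ C * Real.exp (-(mh k * n))) →
      (∀ k S₀ : ℕ, ∃ A B : YMSpecies G, ∀ C : ℝ, ∃ S n : ℕ, S₀ ≤ S ∧ n ≤ S ∧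
        C * Real.exp (-(K * mh k * n)) < |latticeConnectedCorr r.ρ (β k) (2 * S + 1) A.F B.F n|) →
      Tendsto mh atTop (𝓝 0) →
      ∃ (a : ℕ → ℝ) (φ : ℕ → ℕ) (Δ₀ : ℝ) (𝓛 : ℕ → Set ℕ),
        (∀ k, 0 < a k) ∧ StrictMono φ ∧ 0 < Δ₀ ∧ (∀ k, Δ₀ * a k ≤ mh (φ k)) ∧
        (∀ k S : ℕ, ∃ S' : ℕ, S' ∈ 𝓛 k ∧ S ≤ S') ∧ (∀ k : ℕ, ∀ S ∈ 𝓛 k, S₁ (φ k) ≤ S) ∧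
        (∃ N : ℕ, 1 ≤ N ∧ ∀ᶠ k in atTop, ∀ S ∈ 𝓛 k, (a k)⁻¹ ≤ (a k * (S : ℝ)) ^ N) ∧
      ∀ (sch : SpeciesScheme (YMSpecies G)), (∀ k, sch.a k = a k) → (∀ k, sch.β k = β (φ k)) →
        (∀ k, sch.L k ∈ 𝓛 k) →
      ∀ (LS : (k n : ℕ) → SchwartzMap (Fin n → EuclideanSpace ℝ (Fin 4)) ℂ → ℂ),
      (∀ (k n : ℕ) (F : SchwartzMap (Fin n → EuclideanSpace ℝ (Fin 4)) ℂ), LS k n F =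
        ∫ U : GaugeConfig 4 (sch.side k) G, ∑ x : Fin n → ↥(Literature.Probability.LatticeModels.box 4 (sch.L k)),
          F (fun i => sch.a k • siteToE ↑(x i)) *
            ∏ i, ((sch.c r.curvature k * sch.a k ^ 4 *
              (r.curvature.F (Literature.MathematicalPhysics.QuantumLattice.configShift (-↑(x i)) (Literature.MathematicalPhysics.QuantumLattice.torusLift (sch.side k) U)) - sch.m r.curvature k) : ℝ) : ℂ)
          ∂(wilsonMeasure r.ρ (sch.β k))) →
      (∀ k : ℕ, sch.m r.curvature k =
        ∫ U : GaugeConfig 4 (sch.side k) G, r.curvature.F (Literature.MathematicalPhysics.QuantumLattice.torusLift (sch.side k) U) ∂(wilsonMeasure r.ρ (sch.β k))) →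
      (∀ k : ℕ, sch.c r.curvature k = (sch.a k ^ 4)⁻¹) →
      (∃ (s : ℕ) (α β' : ℝ), ∀ᶠ k in atTop, ∀ (p : ℕ) (q : Fin p → {q : Fin 4 × Fin 4 // q.1 < q.2})
        (F : SchwartzMap (Fin p → EuclideanSpace ℝ (Fin 4)) ℂ), IsOffDiagonal F →
        ‖∫ U : GaugeConfig 4 (sch.side k) G, ∑ x : Fin p → ↥(Literature.Probability.LatticeModels.box 4 (sch.L k)),
            F (fun i => sch.a k • siteToE ↑(x i)) *
              ∏ i, ((plaquetteObs r.ρ 0 (q i).1.1 (q i).1.2 (Literature.MathematicalPhysics.QuantumLattice.configShift (-↑(x i)) (Literature.MathematicalPhysics.QuantumLattice.torusLift (sch.side k) U)) -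
                wilsonTorusMean r.ρ (sch.β k) (sch.L k) (plaquetteObs r.ρ 0 (q i).1.1 (q i).1.2) : ℝ) : ℂ)
            ∂(wilsonMeasure r.ρ (sch.β k))‖ ≤ α * (p.factorial : ℝ) ^ β' * schwartzNorm (p * s) F) ∧
      (∃ (f g : SchwartzMap (Fin 1 → EuclideanSpace ℝ (Fin 4)) ℂ)
        (H : SchwartzMap (Fin (1 + 1) → EuclideanSpace ℝ (Fin 4)) ℂ),
        IsTimeOrdered f ∧ IsTimeOrdered g ∧ IsAppendTensorOf H (osAdjoint f) g ∧
          ∃ δ : ℝ, 0 < δ ∧ ∀ᶠ k in atTop, δ ≤ ‖LS k (1 + 1) H‖) ∧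
      (∀ R : EuclideanSpace ℝ (Fin 4) ≃ₗᵢ[ℝ] EuclideanSpace ℝ (Fin 4),
        R (EuclideanSpace.single 0 1) =
          (3 / 5 : ℝ) • EuclideanSpace.single 0 1 + (-(4 / 5) : ℝ) • EuclideanSpace.single 1 1 →
        R (EuclideanSpace.single 1 1) =
          (4 / 5 : ℝ) • EuclideanSpace.single 0 1 + (3 / 5 : ℝ) • EuclideanSpace.single 1 1 →
        R (EuclideanSpace.single 2 1) = EuclideanSpace.single 2 1 →
        R (EuclideanSpace.single 3 1) = EuclideanSpace.single 3 1 →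
        ∀ (n : ℕ) (F : SchwartzMap (Fin n → EuclideanSpace ℝ (Fin 4)) ℂ), IsOffDiagonal F →
          Tendsto (fun k : ℕ => LS k n (linActMulti R F) - LS k n F) atTop (𝓝 0))) →
    (∀ (G : Type) [Group G] [TopologicalSpace G] [IsTopologicalGroup G] [CompactSpace G]
      [MeasurableSpace G] [BorelSpace G], IsCompactSimpleLieGroup G →
      ∀ (r : LatticeRep G) (sch : SpeciesScheme (YMSpecies G))
        (LS : (k n : ℕ) → SchwartzMap (Fin n → EuclideanSpace ℝ (Fin 4)) ℂ → ℂ),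
      (∀ (k n : ℕ) (F : SchwartzMap (Fin n → EuclideanSpace ℝ (Fin 4)) ℂ), LS k n F =
        ∫ U : GaugeConfig 4 (sch.side k) G, ∑ x : Fin n → ↥(box 4 (sch.L k)),
          F (fun i => sch.a k • siteToE ↑(x i)) *
            ∏ i, ((sch.c r.curvature k * sch.a k ^ 4 *
              (r.curvature.F (configShift (-↑(x i)) (torusLift (sch.side k) U)) - sch.m r.curvature k) : ℝ) : ℂ)
          ∂(wilsonMeasure r.ρ (sch.β k))) →
      Tendsto sch.β atTop atTop →
      (∀ k : ℕ, sch.m r.curvature k =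
        ∫ U : GaugeConfig 4 (sch.side k) G, r.curvature.F (torusLift (sch.side k) U) ∂(wilsonMeasure r.ρ (sch.β k))) →
      (∃ (s : ℕ) (α β' : ℝ), ∀ (n : ℕ) (F : SchwartzMap (Fin n → EuclideanSpace ℝ (Fin 4)) ℂ),
        IsOffDiagonal F → ∀ᶠ k in atTop, ‖LS k n F‖ ≤ α * (n.factorial : ℝ) ^ β' * schwartzNorm (n * s) F) →
      (∃ (f g : SchwartzMap (Fin 1 → EuclideanSpace ℝ (Fin 4)) ℂ)
        (H : SchwartzMap (Fin (1 + 1) → EuclideanSpace ℝ (Fin 4)) ℂ),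
        IsTimeOrdered f ∧ IsTimeOrdered g ∧ IsAppendTensorOf H (osAdjoint f) g ∧
          ∃ δ : ℝ, 0 < δ ∧ ∀ᶠ k in atTop, δ ≤ ‖LS k (1 + 1) H‖) →
      (∃ Δ : ℝ, 0 < Δ ∧ ∀ (n m : ℕ) (F : SchwartzMap (Fin n → EuclideanSpace ℝ (Fin 4)) ℂ)
        (G' : SchwartzMap (Fin m → EuclideanSpace ℝ (Fin 4)) ℂ), IsTimeOrdered F → IsTimeOrdered G' →
        ∃ C : ℝ, ∀ t : ℝ, 0 ≤ t → ∀ᶠ k in atTop,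
          ∀ H : SchwartzMap (Fin (n + m) → EuclideanSpace ℝ (Fin 4)) ℂ,
            IsAppendTensorOf H (osAdjoint F) (translateMulti (EuclideanSpace.single 0 t) G') →
              ‖LS k (n + m) H - LS k n (osAdjoint F) * LS k m G'‖ ≤ C * Real.exp (-Δ * t)) →
      ∃ (s₃ : ℂ) (φ : ℕ → ℕ) (f g h : ℕ → SchwartzMap (EuclideanSpace ℝ (Fin 4)) ℂ)
        (F₃ : ℕ → SchwartzMap (Fin 3 → EuclideanSpace ℝ (Fin 4)) ℂ) (w : ℕ → ℝ),
        s₃ ≠ 0 ∧ StrictMono φ ∧ (∀ j, 0 < w j) ∧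
          (∀ j, IsTensorOf (F₃ j) ![f j, g j, h j] ∧ IsOffDiagonal (F₃ j)) ∧
          ∀ ε : ℝ, 0 < ε → ∀ᶠ j in atTop, ∀ᶠ k in atTop, ‖LS (φ k) 3 (F₃ j) / (w j : ℂ) - s₃‖ ≤ ε) →
    GronwallGap.ContinuumFromLatticeGap := by
  intro hXi hUV hSk G _ _ _ _ hG
  letI : MeasurableSpace G := borel G
  haveI : BorelSpace G := ⟨rfl⟩
  intro hgap
  exact cflgSplit_concl hXi hUV hSk hG hgap

/-- **One UV debt for both shared existence legs.** The same three hypotheses close crux stmt-15915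
(`GronwallGap.ContinuumFromLatticeGap`: gap off a locally finite exceptional set, per-pair thresholds) AND crux
stmt-15828 (`ConvexGribovBody.ContinuumLegGivenGap`: gap on a half-line, pair-free threshold; stmt-15828's landed
`ContinuumLegGivenGap_of_subs_all`). [folklore] -/
theorem continuumFromLatticeGap_and_continuumLegGivenGap_of_subs :
    DirichletWindow.XiDiverges →
    (∀ (G : Type) [Group G] [TopologicalSpace G] [IsTopologicalGroup G] [CompactSpace G]
      [MeasurableSpace G] [BorelSpace G], IsCompactSimpleLieGroup G → ∃ r : LatticeRep G,
      ∀ (β : ℕ → ℝ) (mh : ℕ → ℝ) (S₁ : ℕ → ℕ) (K : ℝ), Tendsto β atTop atTop → (∀ k, 0 < mh k) → 0 < K →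
      (∀ A B : YMSpecies G, ∃ C : ℝ, ∀ k S n : ℕ, S₁ k ≤ S → n ≤ S →
        |latticeConnectedCorr r.ρ (β k) (2 * S + 1) A.F B.F n| ≤ C * Real.exp (-(mh k * n))) →
      (∀ k S₀ : ℕ, ∃ A B : YMSpecies G, ∀ C : ℝ, ∃ S n : ℕ, S₀ ≤ S ∧ n ≤ S ∧
        C * Real.exp (-(K * mh k * n)) < |latticeConnectedCorr r.ρ (β k) (2 * S + 1) A.F B.F n|) →
      Tendsto mh atTop (𝓝 0) →
      ∃ (a : ℕ → ℝ) (φ : ℕ → ℕ) (Δ₀ : ℝ) (𝓛 : ℕ → Set ℕ),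
        (∀ k, 0 < a k) ∧ StrictMono φ ∧ 0 < Δ₀ ∧ (∀ k, Δ₀ * a k ≤ mh (φ k)) ∧
        (∀ k S : ℕ, ∃ S' : ℕ, S' ∈ 𝓛 k ∧ S ≤ S') ∧ (∀ k : ℕ, ∀ S ∈ 𝓛 k, S₁ (φ k) ≤ S) ∧
        (∃ N : ℕ, 1 ≤ N ∧ ∀ᶠ k in atTop, ∀ S ∈ 𝓛 k, (a k)⁻¹ ≤ (a k * (S : ℝ)) ^ N) ∧
      ∀ (sch : SpeciesScheme (YMSpecies G)), (∀ k, sch.a k = a k) → (∀ k, sch.β k = β (φ k)) →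
        (∀ k, sch.L k ∈ 𝓛 k) →
      ∀ (LS : (k n : ℕ) → SchwartzMap (Fin n → EuclideanSpace ℝ (Fin 4)) ℂ → ℂ),
      (∀ (k n : ℕ) (F : SchwartzMap (Fin n → EuclideanSpace ℝ (Fin 4)) ℂ), LS k n F =
        ∫ U : GaugeConfig 4 (sch.side k) G, ∑ x : Fin n → ↥(Literature.Probability.LatticeModels.box 4 (sch.L k)),
          F (fun i => sch.a k • siteToE ↑(x i)) *
            ∏ i, ((sch.c r.curvature k * sch.a k ^ 4 *
              (r.curvature.F (Literature.MathematicalPhysics.QuantumLattice.configShift (-↑(x i)) (Literature.MathematicalPhysics.QuantumLattice.torusLift (sch.side k) U)) - sch.m r.curvature k) : ℝ) : ℂ)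
          ∂(wilsonMeasure r.ρ (sch.β k))) →
      (∀ k : ℕ, sch.m r.curvature k =
        ∫ U : GaugeConfig 4 (sch.side k) G, r.curvature.F (Literature.MathematicalPhysics.QuantumLattice.torusLift (sch.side k) U) ∂(wilsonMeasure r.ρ (sch.β k))) →
      (∀ k : ℕ, sch.c r.curvature k = (sch.a k ^ 4)⁻¹) →
      (∃ (s : ℕ) (α β' : ℝ), ∀ᶠ k in atTop, ∀ (p : ℕ) (q : Fin p → {q : Fin 4 × Fin 4 // q.1 < q.2})
        (F : SchwartzMap (Fin p → EuclideanSpace ℝ (Fin 4)) ℂ), IsOffDiagonal F →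
        ‖∫ U : GaugeConfig 4 (sch.side k) G, ∑ x : Fin p → ↥(Literature.Probability.LatticeModels.box 4 (sch.L k)),
            F (fun i => sch.a k • siteToE ↑(x i)) *
              ∏ i, ((plaquetteObs r.ρ 0 (q i).1.1 (q i).1.2 (Literature.MathematicalPhysics.QuantumLattice.configShift (-↑(x i)) (Literature.MathematicalPhysics.QuantumLattice.torusLift (sch.side k) U)) -
                wilsonTorusMean r.ρ (sch.β k) (sch.L k) (plaquetteObs r.ρ 0 (q i).1.1 (q i).1.2) : ℝ) : ℂ)
            ∂(wilsonMeasure r.ρ (sch.β k))‖ ≤ α * (p.factorial : ℝ) ^ β' * schwartzNorm (p * s) F) ∧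
      (∃ (f g : SchwartzMap (Fin 1 → EuclideanSpace ℝ (Fin 4)) ℂ)
        (H : SchwartzMap (Fin (1 + 1) → EuclideanSpace ℝ (Fin 4)) ℂ),
        IsTimeOrdered f ∧ IsTimeOrdered g ∧ IsAppendTensorOf H (osAdjoint f) g ∧
          ∃ δ : ℝ, 0 < δ ∧ ∀ᶠ k in atTop, δ ≤ ‖LS k (1 + 1) H‖) ∧
      (∀ R : EuclideanSpace ℝ (Fin 4) ≃ₗᵢ[ℝ] EuclideanSpace ℝ (Fin 4),
        R (EuclideanSpace.single 0 1) =
          (3 / 5 : ℝ) • EuclideanSpace.single 0 1 + (-(4 / 5) : ℝ) • EuclideanSpace.single 1 1 →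
        R (EuclideanSpace.single 1 1) =
          (4 / 5 : ℝ) • EuclideanSpace.single 0 1 + (3 / 5 : ℝ) • EuclideanSpace.single 1 1 →
        R (EuclideanSpace.single 2 1) = EuclideanSpace.single 2 1 →
        R (EuclideanSpace.single 3 1) = EuclideanSpace.single 3 1 →
        ∀ (n : ℕ) (F : SchwartzMap (Fin n → EuclideanSpace ℝ (Fin 4)) ℂ), IsOffDiagonal F →
          Tendsto (fun k : ℕ => LS k n (linActMulti R F) - LS k n F) atTop (𝓝 0))) →
    (∀ (G : Type) [Group G] [TopologicalSpace G] [IsTopologicalGroup G] [CompactSpace G]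
      [MeasurableSpace G] [BorelSpace G], IsCompactSimpleLieGroup G →
      ∀ (r : LatticeRep G) (sch : SpeciesScheme (YMSpecies G))
        (LS : (k n : ℕ) → SchwartzMap (Fin n → EuclideanSpace ℝ (Fin 4)) ℂ → ℂ),
      (∀ (k n : ℕ) (F : SchwartzMap (Fin n → EuclideanSpace ℝ (Fin 4)) ℂ), LS k n F =
        ∫ U : GaugeConfig 4 (sch.side k) G, ∑ x : Fin n → ↥(box 4 (sch.L k)),
          F (fun i => sch.a k • siteToE ↑(x i)) *
            ∏ i, ((sch.c r.curvature k * sch.a k ^ 4 *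
              (r.curvature.F (configShift (-↑(x i)) (torusLift (sch.side k) U)) - sch.m r.curvature k) : ℝ) : ℂ)
          ∂(wilsonMeasure r.ρ (sch.β k))) →
      Tendsto sch.β atTop atTop →
      (∀ k : ℕ, sch.m r.curvature k =
        ∫ U : GaugeConfig 4 (sch.side k) G, r.curvature.F (torusLift (sch.side k) U) ∂(wilsonMeasure r.ρ (sch.β k))) →
      (∃ (s : ℕ) (α β' : ℝ), ∀ (n : ℕ) (F : SchwartzMap (Fin n → EuclideanSpace ℝ (Fin 4)) ℂ),
        IsOffDiagonal F → ∀ᶠ k in atTop, ‖LS k n F‖ ≤ α * (n.factorial : ℝ) ^ β' * schwartzNorm (n * s) F) →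
      (∃ (f g : SchwartzMap (Fin 1 → EuclideanSpace ℝ (Fin 4)) ℂ)
        (H : SchwartzMap (Fin (1 + 1) → EuclideanSpace ℝ (Fin 4)) ℂ),
        IsTimeOrdered f ∧ IsTimeOrdered g ∧ IsAppendTensorOf H (osAdjoint f) g ∧
          ∃ δ : ℝ, 0 < δ ∧ ∀ᶠ k in atTop, δ ≤ ‖LS k (1 + 1) H‖) →
      (∃ Δ : ℝ, 0 < Δ ∧ ∀ (n m : ℕ) (F : SchwartzMap (Fin n → EuclideanSpace ℝ (Fin 4)) ℂ)
        (G' : SchwartzMap (Fin m → EuclideanSpace ℝ (Fin 4)) ℂ), IsTimeOrdered F → IsTimeOrdered G' →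
        ∃ C : ℝ, ∀ t : ℝ, 0 ≤ t → ∀ᶠ k in atTop,
          ∀ H : SchwartzMap (Fin (n + m) → EuclideanSpace ℝ (Fin 4)) ℂ,
            IsAppendTensorOf H (osAdjoint F) (translateMulti (EuclideanSpace.single 0 t) G') →
              ‖LS k (n + m) H - LS k n (osAdjoint F) * LS k m G'‖ ≤ C * Real.exp (-Δ * t)) →
      ∃ (s₃ : ℂ) (φ : ℕ → ℕ) (f g h : ℕ → SchwartzMap (EuclideanSpace ℝ (Fin 4)) ℂ)
        (F₃ : ℕ → SchwartzMap (Fin 3 → EuclideanSpace ℝ (Fin 4)) ℂ) (w : ℕ → ℝ),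
        s₃ ≠ 0 ∧ StrictMono φ ∧ (∀ j, 0 < w j) ∧
          (∀ j, IsTensorOf (F₃ j) ![f j, g j, h j] ∧ IsOffDiagonal (F₃ j)) ∧
          ∀ ε : ℝ, 0 < ε → ∀ᶠ j in atTop, ∀ᶠ k in atTop, ‖LS (φ k) 3 (F₃ j) / (w j : ℂ) - s₃‖ ≤ ε) →
    GronwallGap.ContinuumFromLatticeGap ∧ ConvexGribovBody.ContinuumLegGivenGap :=
  fun h₁ h₂ h₃ => ⟨continuumFromLatticeGap_of_subs h₁ h₂ h₃, (ContinuumLegGivenGap_of_subs_all h₁ h₂ h₃).2.1⟩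

end Summit.QuantumFields.YangMills.Theorems.ContinuumFromLatticeGap

end
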